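import Summits.Ventures.LatticeQCDFlow.Scoring.NonabelianAreaLaw2DDisjointLoops
import Summits.Ventures.LatticeQCDFlow.Scoring.NonabelianAreaLaw2DOpenWilsonLoop
import HarnessLib

/-!
# The exact non-abelian area law in two dimensions, VII-b: free-boundary loop expectations do not see extra columns — `∫ σ(W_{R₁×T})_{cd} ∏_{B_{(R₁'+R₂)×T}} w = (∫w)^{R₂T} · ∫ σ(W_{R₁×T})_{cd} ∏_{B_{R₁'×T}} w`

HONEST FRAMING: exact (Metropolis-corrected) sampling algorithms for lattice gauge theory;
figures of merit are autocorrelation/cost numbers at stated couplings and volumes; no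
continuum-physics claim.

Venture `LatticeQCDFlow` (cell pub-lqcd), sub-topic `Scoring`; FANOUT row 5 (`s0-sun-a`), GEN-21.
NEW WORK of the cell (placement rule).  Part VII (`NonabelianAreaLaw2DDisjointLoops`) with the TRIVIAL representation for
the right loop: for every compact `G`, continuous class weight `w`, continuous `σ`, on `(ℤ/L)²` with `R₁ ≤ R₁'`,
`R₁' + R₂ + 1 ≤ L`, `T + 1 ≤ L`,

  **`∫ σ(W_{R₁×T})_{cd} ∏_{p ∈ B_{(R₁'+R₂)×T}} w(U_p) = (∫ w)^{R₂T} · ∫ σ(W_{R₁×T})_{cd} ∏_{p ∈ B_{R₁'×T}} w(U_p)`**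

(`integral_rep_mul_prod_weight_block_add`): the `R₂T` plaquettes to the right of the loop's block contribute only their
partition function `(∫w)^{R₂T}` (GEN-18 `integral_prod_weight_rect`), so the normalised free-boundary expectation of
`σ(W)_{cd}` — and of every function of the loop — is the same in every block `B_{R×T} ⊇ B_{R₁'×T}` of the same height:
**`integral_rep_mul_prod_weight_block_div_eq`**.  This is the locality that makes the product form of part VII read
`⟨ρ(W)σ(W')⟩ = ⟨ρ(W)⟩⟨σ(W')⟩` with each mean taken in the loop's own block.

No `def`, nothing cited as a fact, 0 sorry.
-/

noncomputable section

open MeasureTheory Function Finset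
open Literature.MathematicalPhysics.QuantumFieldTheory
open Summit.Ventures.LatticeQCDFlow.Theory2.Lattice
open Summit.Ventures.LatticeQCDFlow.Theory2.Lattice.TwoDim

namespace Summit.Ventures.LatticeQCDFlow.Scoring

variable {L : ℕ} [NeZero L] {G : Type*} [Group G] [TopologicalSpace G] [IsTopologicalGroup G]
  [CompactSpace G] [SecondCountableTopology G] [MeasurableSpace G] [BorelSpace G]

section Locality

/-- **EXTRA COLUMNS CONTRIBUTE ONLY THEIR PARTITION FUNCTION**: for the loop `W_{R₁×T}` with corner `(i, j)`,
`R₁ ≤ R₁'`, weighted on the `(R₁' + R₂) × T` block with corner `(i, j)`: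
`∫ σ(W)_{cd} ∏_{B_{(R₁'+R₂)×T}} w = (∫ w)^{R₂T} · ∫ σ(W)_{cd} ∏_{B_{R₁'×T}} w`. -/
theorem integral_rep_mul_prod_weight_block_add {m : Type*} [Fintype m] [DecidableEq m]
    (σ : G →* Matrix m m ℂ) (hσ : Continuous σ) {w : G → ℝ} (hw : Continuous w)
    (hwc : ∀ k g, w (k * g * k⁻¹) = w g) (i j : ZMod L) {T : ℕ} (hT : T + 1 ≤ L) {R₁ R₁' R₂ : ℕ}
    (hR₁ : R₁ ≤ R₁') (hR : R₁' + R₂ + 1 ≤ L) (c₀ d₀ : m) :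
    ∫ U, σ (rectangleHolonomy U ![i, j] 0 1 R₁ T) c₀ d₀ *
        ∏ p ∈ (range (R₁' + R₂) ×ˢ range T).image (fun q : ℕ × ℕ => (![i + q.1, j + q.2] : Site 2 L)),
          (w (plaquetteHolonomy U p 0 1) : ℂ) ∂(Measure.pi fun _ : Edge 2 L => haarProbability G) =
      (∫ g, (w g : ℂ) ∂(haarProbability G)) ^ (R₂ * T) *
        ∫ U, σ (rectangleHolonomy U ![i, j] 0 1 R₁ T) c₀ d₀ *
          ∏ p ∈ (range R₁' ×ˢ range T).image (fun q : ℕ × ℕ => (![i + q.1, j + q.2] : Site 2 L)),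
            (w (plaquetteHolonomy U p 0 1) : ℂ) ∂(Measure.pi fun _ : Edge 2 L => haarProbability G) := by
  have h1 : Continuous ((1 : G →* Matrix (Fin 1) (Fin 1) ℂ) : G → Matrix (Fin 1) (Fin 1) ℂ) := by
    have hcoe : ((1 : G →* Matrix (Fin 1) (Fin 1) ℂ) : G → Matrix (Fin 1) (Fin 1) ℂ) = fun _ => 1 :=
      funext fun g => MonoidHom.one_apply g
    rw [hcoe]
    exact continuous_const
  have h := integral_rep_rectangleHolonomy_shifted_mul_rep_mul_prod_weight (L := L) (1 : G →* Matrix (Fin 1) (Fin 1) ℂ)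
    σ h1 hσ hw hwc i j hT hR₁ c₀ d₀ R₂ hR 0 0
  simp only [MonoidHom.one_apply, Matrix.one_apply_eq, one_mul, pow_apply_fin_one, Matrix.of_apply] at h
  exact h

/-- **FREE-BOUNDARY LOOP EXPECTATIONS ARE BLOCK-INDEPENDENT**: with `∫ w ≠ 0`, the normalised expectation of
`σ(W_{R₁×T})_{cd}` in the block `B_{(R₁'+R₂)×T}` equals the one in the block `B_{R₁'×T}` (`R₁ ≤ R₁'`). -/
theorem integral_rep_mul_prod_weight_block_div_eq {m : Type*} [Fintype m] [DecidableEq m]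
    (σ : G →* Matrix m m ℂ) (hσ : Continuous σ) {w : G → ℝ} (hw : Continuous w)
    (hwc : ∀ k g, w (k * g * k⁻¹) = w g) (hw0 : ∫ g, w g ∂(haarProbability G) ≠ 0) (i j : ZMod L) {T : ℕ}
    (hT : T + 1 ≤ L) {R₁ R₁' R₂ : ℕ} (hR₁ : R₁ ≤ R₁') (hR : R₁' + R₂ + 1 ≤ L) (c₀ d₀ : m) :
    (∫ U, σ (rectangleHolonomy U ![i, j] 0 1 R₁ T) c₀ d₀ *
        ∏ p ∈ (range (R₁' + R₂) ×ˢ range T).image (fun q : ℕ × ℕ => (![i + q.1, j + q.2] : Site 2 L)),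
          (w (plaquetteHolonomy U p 0 1) : ℂ) ∂(Measure.pi fun _ : Edge 2 L => haarProbability G)) /
      ((∫ U, ∏ p ∈ (range (R₁' + R₂) ×ˢ range T).image (fun q : ℕ × ℕ => (![i + q.1, j + q.2] : Site 2 L)),
          w (plaquetteHolonomy U p 0 1) ∂(Measure.pi fun _ : Edge 2 L => haarProbability G) : ℝ) : ℂ) =
    (∫ U, σ (rectangleHolonomy U ![i, j] 0 1 R₁ T) c₀ d₀ *
        ∏ p ∈ (range R₁' ×ˢ range T).image (fun q : ℕ × ℕ => (![i + q.1, j + q.2] : Site 2 L)),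
          (w (plaquetteHolonomy U p 0 1) : ℂ) ∂(Measure.pi fun _ : Edge 2 L => haarProbability G)) /
      ((∫ U, ∏ p ∈ (range R₁' ×ˢ range T).image (fun q : ℕ × ℕ => (![i + q.1, j + q.2] : Site 2 L)),
          w (plaquetteHolonomy U p 0 1) ∂(Measure.pi fun _ : Edge 2 L => haarProbability G) : ℝ) : ℂ) := by
  rw [integral_rep_mul_prod_weight_block_add σ hσ hw hwc i j hT hR₁ hR c₀ d₀,
    integral_prod_weight_rect hw hwc i j hR hT, integral_prod_weight_rect hw hwc i j (by omega) hT,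
    integral_complex_ofReal, Complex.ofReal_pow, Complex.ofReal_pow,
    show (R₁' + R₂) * T = R₂ * T + R₁' * T by ring, pow_add]
  have hz : ((∫ g, w g ∂(haarProbability G) : ℝ) : ℂ) ≠ 0 := by exact_mod_cast hw0
  rw [mul_div_mul_left _ _ (pow_ne_zero _ hz)]

end Locality

end Summit.Ventures.LatticeQCDFlow.Scoring
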